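import Mathlib
import Summits.MatrixMultiplication.Statement
import Summits.MatrixMultiplication.MatrixMultiplication.Theorems.GraphEquationsFlatPersistence
import Summits.MatrixMultiplication.MatrixMultiplication.Theorems.GraphEquationsCubicDictionary
import Summits.MatrixMultiplication.MatrixMultiplication.Theorems.GraphEquationsTangentWords
import Summits.MatrixMultiplication.MatrixMultiplication.Theorems.GraphEquationsDegreeDials

/-!
# The horizontal derivation `X_{U,V}` on `ℂ[A,B,C]` and the affine calculus (`GraphEquations`, M60a)

Decomp-mm node «GraphEquations» (lens 5, g42); attacked leaf `MultiplicityReduction`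
(stmt-MatrixMultiplication-27806).  Target VERBATIM: `_root_.MatrixMultiplication`.  Route-neutral.

The BRIDGE between the coefficient-level horizontal calculus of M57/M58 (`AffTest.hderiv`,
`AffSystem.happend₂`, `PersistsAlong`) and the polynomial-level TANGENT-WORD ENGINE of M20c
(`EqSystem.tensorRank_le_of_tangentWordsAt`).  For a base direction `v = (U,V)` the HORIZONTAL FIELD
`X_v = Σ U_e ∂/∂a_e + Σ V_e ∂/∂b_e + Σ_q (Ub + aV)_q ∂/∂c_q` is the derivation `hDer U V` of
`ℂ[A,B,C]`; we prove

* `hDer_affine`, `hDer_generator` — `X_v` has affine values on variables (AD cost `× 3`) and KILLS THE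
  GENERATORS `f_q = c_q − (ab)_q` (it is tangent to the graph): the two hypotheses of the engine;
* `hDer_poly` — **`X_v (g.poly) = (g.hderiv U V).poly`**: on the polynomial of an affine test the field
  acts exactly as the coefficient-level horizontal derivative of M57 (`eq_poly_of_eval_eq`);
* `hDer_translate` — **`X_v` commutes with the base translations `τ_y`** (the graph translations are
  symmetries of the bilinear `c`-component), so words in `X_v` applied to translated tests are translated
  polys of iterated `hderiv`s (`foldl_hDer_translate_poly`);
* `linRow_translate_poly` — the linear `c`-row of `τ_y (g.poly)` at `y = (A,B)` is `g.jac A B`.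
M60b (`GraphEquationsHorizontalEngine`) feeds these to the engine: two rounds along ONE direction that
purify at ONE base give `R(⟨n,n,n⟩) ≤ 18·cost`.
Sources: [BurgisserClausenShokrollahi1997, §4.1 Rem. (4.3), (7.7), Problem 16.3];
[LeykinVerscheldeZhao2006, Thm. 3.1]; the cell's M20c/M57/M58.  No `sorry`.
-/

-- dupNamespace: forced by the nested Summit.MatrixMultiplication.MatrixMultiplication layout (D-0017)
set_option linter.dupNamespace false

noncomputable section

namespace Summit.MatrixMultiplication.MatrixMultiplication.Theorems.GraphEquations

open Matrix MvPolynomial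
open Literature.Computability.AlgebraicComplexity

variable {n : ℕ}

/-! ## The horizontal field as a derivation -/

/-- Values of the horizontal field `X_{U,V}` on the variables: `a_e ↦ U_e`, `b_e ↦ V_e`,
`c_q ↦ (U b + a V)_q`. -/
def hField (U V : Vec n) : GraphVars n → MvPolynomial (GraphVars n) ℂ
  | Sum.inl (Sum.inl v) => C (U v)
  | Sum.inl (Sum.inr w) => C (V w)
  | Sum.inr q => ∑ k, (C (U (q.1, k)) * X (bVar (k, q.2)) + X (aVar (q.1, k)) * C (V (k, q.2)))

/-- The horizontal derivation `X_{U,V}` of `ℂ[A,B,C]`. -/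
def hDer (U V : Vec n) : Derivation ℂ (MvPolynomial (GraphVars n) ℂ) (MvPolynomial (GraphVars n) ℂ) :=
  mkDerivation ℂ (hField U V)

/-- `X_{U,V}` on a variable. -/
theorem hDer_X (U V : Vec n) (v : GraphVars n) : hDer U V (X v) = hField U V v :=
  mkDerivation_X _ _ _

/-- `X_{U,V}` kills constants. -/
theorem hDer_C (U V : Vec n) (a : ℂ) : hDer U V (C a : MvPolynomial (GraphVars n) ℂ) = 0 :=
  (hDer U V).map_algebraMap a

/-- **`X_{U,V}` has AFFINE values on the variables** (so AD along it costs `× 3`, M20c). -/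
theorem hDer_affine (U V : Vec n) (v : GraphVars n) :
    hDer U V (X v) ∈ freeSpan (∅ : Set (MvPolynomial (GraphVars n) ℂ)) := by
  rw [hDer_X]
  rcases v with (v | w) | q
  · exact C_mem_freeSpan _ _
  · exact C_mem_freeSpan _ _
  · refine Submodule.sum_mem _ fun k _ => Submodule.add_mem _ ?_ ?_
    · rw [C_mul']
      exact Submodule.smul_mem _ _ (X_mem_freeSpan _ _)
    · rw [mul_comm, C_mul']
      exact Submodule.smul_mem _ _ (X_mem_freeSpan _ _)

/-- **`X_{U,V}` KILLS THE GENERATORS**: `X_v (c_q − Σ_k a_{q₁k} b_{kq₂}) = (Ub + aV)_q − (Ub + aV)_q = 0`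
(the field is tangent to the graph). -/
theorem hDer_generator (U V : Vec n) (q : Fin n × Fin n) : hDer U V (generator n q) = 0 := by
  obtain ⟨q₁, q₂⟩ := q
  simp only [generator, map_sub, map_sum, Derivation.leibniz, hDer_X, hField, smul_eq_mul, aVar, bVar]
  rw [sub_eq_zero]
  exact Finset.sum_congr rfl fun k _ => by ring

/-! ## Values: the field differentiates affine tests as `hderiv` -/

/-- Value of the field on an `a`-variable. -/
@[simp] theorem eval_hField_a (U V A B W : Vec n) (v : Fin n × Fin n) :
    MvPolynomial.eval (pt A B W) (hField U V (Sum.inl (Sum.inl v))) = U v := by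
  simp [hField]

/-- Value of the field on a `b`-variable. -/
@[simp] theorem eval_hField_b (U V A B W : Vec n) (w : Fin n × Fin n) :
    MvPolynomial.eval (pt A B W) (hField U V (Sum.inl (Sum.inr w))) = V w := by
  simp [hField]

/-- Value of the field on a `c`-variable: `(UB + AV)_q`. -/
@[simp] theorem eval_hField_c (U V A B W : Vec n) (q : Fin n × Fin n) :
    MvPolynomial.eval (pt A B W) (hField U V (Sum.inr q)) = (prodVec U B + prodVec A V) q := by
  simp [hField, prodVec, prodEntry, aVar, bVar, Finset.sum_add_distrib, mul_comm]

namespace AffTest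

variable (g : AffTest n) (U V : Vec n)

/-- `X_v` of a coefficient polynomial, evaluated: the coefficient of `hderiv`. -/
theorem eval_hDer_coefPoly (q : Fin n × Fin n) (A B W : Vec n) :
    MvPolynomial.eval (pt A B W) (hDer U V (g.coefPoly q)) = (g.hderiv U V).coef A B W q := by
  simp only [coefPoly, map_add, map_sum, Derivation.leibniz, hDer_X, hDer_C, smul_eq_mul, mul_zero,
    zero_add, add_zero, map_mul, eval_C, eval_hField_a, eval_hField_b, eval_hField_c, coef_hderiv,
    aVar, bVar, cVar]
  simp only [Pi.add_apply, mulVec, dotProduct, Finset.sum_add_distrib, mul_add]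

/-- `X_v` of the test polynomial, evaluated: the value of the horizontal derivative `hderiv`. -/
theorem eval_hDer_poly (A B W : Vec n) :
    MvPolynomial.eval (pt A B W) (hDer U V g.poly) = (g.hderiv U V).eval A B W := by
  rw [poly, map_sum, map_sum, AffTest.eval, dotProduct]
  refine Finset.sum_congr rfl fun q _ => ?_
  rw [Derivation.leibniz, hDer_generator, smul_zero, zero_add, smul_eq_mul, map_mul, eval_pt_generator,
    eval_hDer_coefPoly, Pi.sub_apply, mul_comm]

/-- **`X_v (g.poly) = (g.hderiv U V).poly`**: the horizontal field acts on affine tests as the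
coefficient-level horizontal derivative of M57. -/
theorem hDer_poly : hDer U V g.poly = (g.hderiv U V).poly :=
  eq_poly_of_eval_eq fun A B W => g.eval_hDer_poly U V A B W

end AffTest

/-! ## The field commutes with the base translations -/

/-- `X_v` commutes with `τ_y` on variables. -/
theorem hDer_translate_X (U V : Vec n) (y : MatMulVars n → ℂ) (v : GraphVars n) :
    hDer U V (translate y (X v)) = translate y (hDer U V (X v)) := by
  rw [translate_eq, bind₁_X_right, hDer_X]
  rcases v with (v | w) | ⟨i, l⟩
  · simp [shift, hDer_X, hField, translate_eq]
  · simp [shift, hDer_X, hField, translate_eq]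
  · simp only [shift, map_add, map_sum, hDer_X, hDer_C, hField, translate_eq, map_mul, bind₁_C_right,
      bind₁_X_right, aVar, bVar, smul_eq_C_mul, graphPoint, Derivation.leibniz, smul_eq_mul, mul_zero,
      add_zero, Finset.sum_const_zero]
    simp only [mul_add, add_mul, Finset.sum_add_distrib, mul_comm (C (U _)) (C (y _))]
    abel

/-- **`X_v ∘ τ_y = τ_y ∘ X_v`**: the horizontal field is invariant under the graph translations. -/
theorem hDer_translate (U V : Vec n) (y : MatMulVars n → ℂ) (t : MvPolynomial (GraphVars n) ℂ) :
    hDer U V (translate y t) = translate y (hDer U V t) := by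
  induction t using MvPolynomial.induction_on with
  | C a => rw [translate_C, hDer_C, translate_eq, map_zero]
  | add p q hp hq => rw [translate_add, map_add, map_add, translate_add, hp, hq]
  | mul_X p v hp =>
      rw [translate_mul, Derivation.leibniz, Derivation.leibniz, hp, hDer_translate_X, smul_eq_mul,
        smul_eq_mul, smul_eq_mul, smul_eq_mul, translate_add, translate_mul, translate_mul]

/-- A word in horizontal fields applied to a translated affine test is the translate of the polynomial
of the iterated horizontal derivative. -/
theorem foldl_hDer_translate_poly (y : MatMulVars n → ℂ) :
    ∀ (L : List (Vec n × Vec n)) (g : AffTest n),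
      (L.map fun uv => hDer uv.1 uv.2).foldl (fun acc D => D acc) (translate y g.poly) =
        translate y (L.foldl (fun h uv => h.hderiv uv.1 uv.2) g).poly
  | [], g => rfl
  | uv :: L, g => by
      rw [List.map_cons, List.foldl_cons, List.foldl_cons, hDer_translate, AffTest.hDer_poly]
      exact foldl_hDer_translate_poly y L _

/-! ## Linear `c`-rows of translated tests -/

/-- The graph point over `y = (A,B)` is `(A, B, AB)`. -/
theorem graphPoint_sumElim (A B : Vec n) : graphPoint (Sum.elim A B) = pt A B (prodVec A B) := by
  funext v
  rcases v with v | ⟨i, l⟩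
  · rcases v with v | v <;> rfl
  · simp [graphPoint, pt, prodVec, prodEntry]

/-- **The linear `c`-row of `τ_{(A,B)} (g.poly)` is the `C`-gradient `g.jac A B`.** -/
theorem linRow_translate_poly (g : AffTest n) (A B : Vec n) (q : Fin n × Fin n) :
    MvPolynomial.coeff (Finsupp.single (Sum.inr q : GraphVars n) 1) (translate (Sum.elim A B) g.poly) =
      g.jac A B q := by
  rw [translate_eq, coeff_inr_bind₁_shift, graphPoint_sumElim, AffTest.eval_pderiv_poly]

/-- The linear `c`-row of a horizontal word on a translated affine test is the `C`-gradient of the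
iterated horizontal derivative. -/
theorem linRow_foldl_hDer (L : List (Vec n × Vec n)) (g : AffTest n) (A B : Vec n) (q : Fin n × Fin n) :
    MvPolynomial.coeff (Finsupp.single (Sum.inr q : GraphVars n) 1)
      ((L.map fun uv => hDer uv.1 uv.2).foldl (fun acc D => D acc) (translate (Sum.elim A B) g.poly)) =
      (L.foldl (fun h uv => h.hderiv uv.1 uv.2) g).jac A B q := by
  rw [foldl_hDer_translate_poly, linRow_translate_poly]

/-! ## Rows with trivial common kernel span everything -/

/-- If the only vector `⬝ᵥ`-orthogonal to every row `r i` is `0`, every vector is a combination of the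
rows (rank–nullity; used to turn «no persistent kernel vector» into the engine's left inverse `P`). -/
theorem exists_combination_of_forall_dotProduct {ι : Type*} [Fintype ι] (r : ι → Vec n)
    (h : ∀ δ : Vec n, (∀ i, r i ⬝ᵥ δ = 0) → δ = 0) (w : Vec n) :
    ∃ P : ι → ℂ, ∀ q, ∑ i, P i * r i q = w q := by
  classical
  let R : Matrix ι (Fin n × Fin n) ℂ := Matrix.of r
  have hker : LinearMap.ker R.mulVecLin = ⊥ := by
    rw [LinearMap.ker_eq_bot']
    intro δ hδ
    exact h δ fun i => by simpa [R, Matrix.mulVec] using congr_fun hδ i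
  have hdim := LinearMap.finrank_range_add_finrank_ker R.mulVecLin
  rw [hker, finrank_bot, add_zero] at hdim
  have htop : LinearMap.range Rᵀ.mulVecLin = ⊤ := by
    apply Submodule.eq_top_of_finrank_eq
    have ht : Rᵀ.rank = R.rank := Matrix.rank_transpose R
    simpa [Matrix.rank, hdim] using ht
  have hw : w ∈ LinearMap.range Rᵀ.mulVecLin := htop ▸ Submodule.mem_top
  obtain ⟨P, hP⟩ := hw
  refine ⟨P, fun q => ?_⟩
  have hq := congr_fun hP q
  simp only [Matrix.mulVecLin_apply, Matrix.mulVec, dotProduct, Matrix.transpose_apply, R,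
    Matrix.of_apply] at hq
  rw [← hq]
  exact Finset.sum_congr rfl fun i _ => mul_comm _ _

/-! ## Two purifying rounds along one direction feed the engine -/

/-- **THE BRIDGE.**  If `E` is a correct system whose tests are the affine tests `g` (as functions),
and the two-round horizontal system `(S ⊕ ∂_v S) ⊕ ∂_v(S ⊕ ∂_v S)` of `S = affSystemOf g` is REDUCED
at ONE base `(A,B)` for ONE direction `v = (U,V)` — equivalently (M58) no nonzero kernel vector persists
along the line `(A,B) + t v` — then `R(⟨n,n,n⟩) ≤ 2·3²·cost E = 18·cost E`
(engine M20c with `Ξ = [X_v, X_v]` at base `y = (A,B)`). -/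
theorem tensorRank_le_of_reducedAt_happend₂ {E : EqSystem n} (hE : E.Correct)
    {g : Fin E.tests.length → AffTest n}
    (hg : ∀ o A B C, MvPolynomial.eval (pt A B C) (E.testPoly (E.tests.get o)) = (g o).eval A B C)
    {A B U V : Vec n} (hred : ((affSystemOf g).happend₂ U V).ReducedAt A B) :
    tensorRank (matMulTensor ℂ n n n) ≤ 2 * (3 ^ 2 * E.cost) := by
  classical
  have hpoly : ∀ o, E.testPoly (E.tests.get o) = (g o).poly := fun o => eq_poly_of_eval_eq (hg o)
  refine EqSystem.tensorRank_le_of_tangentWordsAt hE.1 (fun j hj => hE.testPoly_mem_graphIdeal' hj)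
    (Sum.elim A B) [hDer U V, hDer U V] ?_ ?_ ?_
  · intro D hD v
    obtain rfl : D = hDer U V := by simpa using hD
    exact hDer_affine U V v
  · intro D hD q
    obtain rfl : D = hDer U V := by simpa using hD
    exact hDer_generator U V q
  · -- the word rows, indexed by (test, sublist)
    let r : Fin E.tests.length × Fin [hDer U V, hDer U V].sublists.length → Vec n := fun os q' =>
      coeff (Finsupp.single (Sum.inr q' : GraphVars n) 1)
        (([hDer U V, hDer U V].sublists.get os.2).foldl (fun acc D => D acc)
          (translate (Sum.elim A B) (E.testPoly (E.tests.get os.1))))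
    have row : ∀ (L : List (Vec n × Vec n)) (s : Fin [hDer U V, hDer U V].sublists.length),
        [hDer U V, hDer U V].sublists.get s = L.map (fun uv => hDer uv.1 uv.2) → ∀ o,
          r (o, s) = (L.foldl (fun h uv => h.hderiv uv.1 uv.2) (g o)).jac A B := by
      intro L s hs o
      funext q'
      simp only [r, hs, hpoly, linRow_foldl_hDer]
    -- only `0` is orthogonal to all word rows: persistence along the line + `hred`
    have hr : ∀ δ : Vec n, (∀ os, r os ⬝ᵥ δ = 0) → δ = 0 := by
      intro δ hδ
      refine AffSystem.reducedAt_happend₂_iff.1 hred δ (AffSystem.persistsAlong_iff.2 ⟨?_, ?_, ?_⟩)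
      · obtain ⟨s₀, hs₀⟩ := List.mem_iff_get.1 (List.mem_sublists.2 (List.nil_sublist [hDer U V, hDer U V]))
        intro o
        have h0 := hδ (o, s₀)
        rwa [row [] s₀ (by simpa using hs₀) o] at h0
      · obtain ⟨s₁, hs₁⟩ := List.mem_iff_get.1
          (List.mem_sublists.2 (((List.Sublist.refl [hDer U V]).cons (hDer U V))))
        intro o
        have h1 := hδ (o, s₁)
        rwa [row [(U, V)] s₁ (by simpa using hs₁) o] at h1
      · obtain ⟨s₂, hs₂⟩ := List.mem_iff_get.1
          (List.mem_sublists.2 (List.Sublist.refl [hDer U V, hDer U V]))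
        intro o
        have h2 := hδ (o, s₂)
        rw [row [(U, V), (U, V)] s₂ (by simpa using hs₂) o] at h2
        simp only [List.foldl_cons, List.foldl_nil, AffTest.jac_hderiv_hderiv, mulVec_add,
          add_dotProduct] at h2
        change ((g o).M *ᵥ prodVec U V) ⬝ᵥ δ = 0
        linear_combination h2 / 2
    intro q
    obtain ⟨P, hP⟩ := exists_combination_of_forall_dotProduct r hr (fun q' => if q = q' then 1 else 0)
    refine ⟨fun o s => P (o, s), fun q' => ?_⟩
    rw [← hP q', Fintype.sum_prod_type]

/-! ## The exponent dial: ONE purifying direction per system forces `ω ≤ β` on the cubic range -/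

/-- **`HorizontalUnmaskOne` (flat rigidity, depth one).**  Every correct CUBIC system for `W_n`
(`n ≥ 3`), in any affine normal form `g` (M27b), has a base `(A,B)` and ONE direction `(U,V)` such that
no nonzero kernel vector persists along the line — i.e. two horizontal rounds purify it there.
TRUE for the pivot/block designs (M57: base `0`, direction `(𝟙,0)`), FALSE direction-wise for the
self-directions `(δ, 𝟙)` (M59); open in general (the cell's question (Q*)). -/
def HorizontalUnmaskOne (n : ℕ) : Prop :=
  ∀ E : EqSystem n, E.Correct → E.IsCubic →
    ∀ g : Fin E.tests.length → AffTest n,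
      (∀ o A B C, MvPolynomial.eval (pt A B C) (E.testPoly (E.tests.get o)) = (g o).eval A B C) →
        ∃ A B U V : Vec n, ((affSystemOf g).happend₂ U V).ReducedAt A B

/-- **`(∀ n ≥ 3, HorizontalUnmaskOne n) → CubicEquationsForceMultiplication`** (the CEFM half of the
attacked leaf `MultiplicityReduction ↔ CEFM ∧ CDR`, M53): cheap correct cubic systems with ONE
purifying direction force `ω ≤ β`, with constant `18`. -/
theorem cubicEquationsForceMultiplication_of_horizontalUnmaskOne
    (h : ∀ n : ℕ, 3 ≤ n → HorizontalUnmaskOne n) : CubicEquationsForceMultiplication := by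
  intro β _ hcub
  obtain ⟨c, hc⟩ := hcub
  have hmem : β ∈ admissibleExponents ℂ := by
    change (fun n : ℕ => (tensorRank (matMulTensor ℂ n n n) : ℝ)) =O[Filter.atTop]
      fun n : ℕ => (n : ℝ) ^ β
    refine Asymptotics.IsBigO.of_bound (18 * |c|) ?_
    filter_upwards [Filter.eventually_ge_atTop 3] with n hn
    obtain ⟨E, hE, hcubic, hcost⟩ := hc n (by omega)
    obtain ⟨g, hg⟩ := exists_affTests hn hE hcubic
    obtain ⟨A, B, U, V, hred⟩ := h n hn E hE hcubic g hg
    have h1 : tensorRank (matMulTensor ℂ n n n) ≤ 18 * E.cost :=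
      (tensorRank_le_of_reducedAt_happend₂ hE hg hred).trans (le_of_eq (by ring))
    rw [Real.norm_of_nonneg (Nat.cast_nonneg _),
      Real.norm_of_nonneg (Real.rpow_nonneg (Nat.cast_nonneg _) _)]
    have h3 : (tensorRank (matMulTensor ℂ n n n) : ℝ) ≤ 18 * (E.cost : ℝ) := by exact_mod_cast h1
    have h4 : c * (n : ℝ) ^ β ≤ |c| * (n : ℝ) ^ β := by
      gcongr
      exact le_abs_self c
    nlinarith [h3, hcost, h4, Real.rpow_nonneg (Nat.cast_nonneg n) β]
  exact csInf_le (admissibleExponents_bddBelow ℂ) hmem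

end Summit.MatrixMultiplication.MatrixMultiplication.Theorems.GraphEquations

end
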